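import Mathlib
import Literature.Analysis.InverseSpectral.StieltjesInversion
import Literature.Analysis.InverseSpectral.StieltjesHolomorphic
import Summits.AtomisticToContinuum.FouriersLaw.Theorems.ContactStieltjesMeasureContactMeasureLimitStubTruncatedConvergence
import Summits.AtomisticToContinuum.FouriersLaw.Theorems.ContactStieltjesMeasureContactMeasureLimitStubLayerCake
import Summits.AtomisticToContinuum.FouriersLaw.Theorems.ContactStieltjesMeasureContactMeasureLimitStubLimitRepresentation
import Summits.AtomisticToContinuum.FouriersLaw.Theorems.ContactStieltjesMeasureContactMeasureLimitStubEscapedMassConstant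

/-!
# Stieltjes data of subsequential limits, and their uniqueness
# (glue for crux `ContactMeasureLimit`, line `IdeatorOneSketch`)

Crux `ContactStieltjesMeasure.ContactMeasureLimit` (stmt-AtomisticToContinuum-15250), line `IdeatorOneSketch`
(idea `escaped-mass-stieltjes-constant`). Two steps of the Stieltjes continuity theorem for the contact kernel
`k_γ(t) = 2t/(γ²+t²)²`:

* `limitData` — composition of the four landed analysis stubs (`stub_truncatedConvergence`,
  `stub_escapedMassConstant`, `stub_layerCake`, `stub_limitRepresentation`): if the contact transforms of a
  family of bounded contact distribution functions converge to `L(γ)` at every friction, the family is pointwise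
  bounded, and it converges to a monotone `G` (zero on `(-∞,0]`) at the continuity points of `G`, then `L` is
  matched at the points `z = -γ²` by Stieltjes data `(e, ν_G)` in the tree's class `N_S`
  (`Literature.Analysis.InverseSpectral.HasStieltjesRepresentation`), `ν_G` the Stieltjes measure of `G` pushed
  forward by `s ↦ s²` and `e ≥ 0` the escaped contact mass;
* `limitData_unique` — two Stieltjes data sets whose functions agree at all `-γ²` coincide (same escaped mass AND
  same measure): the tree's `eqOn_of_hasStieltjesRepresentation_of_eqOn_neg` (values on the negative axis determine
  an `N_S` function, KacKrein1974 Supplement I) and `stieltjes_data_unique` (Stieltjes–Perron inversion).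
-/

noncomputable section

namespace Summit.AtomisticToContinuum.FouriersLaw.Theorems.ContactMeasureLimit

open MeasureTheory Filter Set Topology
open Literature.Analysis.InverseSpectral

/-- **Limit data along a convergent (sub)sequence.** If the contact transforms of a family of bounded contact
distribution functions converge to `L(γ)` at every friction `γ > 0`, the family is pointwise bounded uniformly
in `N`, and it converges to a monotone `G` (zero on `(-∞,0]`) at the continuity points `t > 0` of `G`, then there
are `e ≥ 0` and `q ∈ N_S` with Stieltjes data `(e, ν_G)`, `ν_G = μ_G.map (s ↦ s²)`, such that `q(-γ²) = L(γ)` for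
all `γ > 0`. [folklore] -/
theorem limitData :
    ∀ F : ℕ → ℝ → ℝ,
      (∀ N : ℕ, Monotone (F N) ∧ (∀ s : ℝ, s ≤ 0 → F N s = 0) ∧ ∃ m : ℝ, ∀ s : ℝ, F N s ≤ m) →
      ∀ L : ℝ → ℝ,
      (∀ γ : ℝ, 0 < γ → Filter.Tendsto
        (fun N : ℕ => ∫ t in Set.Ioi (0 : ℝ), F N t * (2 * t / (γ ^ 2 + t ^ 2) ^ 2)) Filter.atTop (nhds (L γ))) →
      (∀ t : ℝ, ∃ C : ℝ, ∀ N : ℕ, F N t ≤ C) →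
      ∀ (G : ℝ → ℝ) (hG : Monotone G), (∀ s : ℝ, s ≤ 0 → G s = 0) →
      (∀ t : ℝ, 0 < t → ContinuousAt G t → Filter.Tendsto (fun N : ℕ => F N t) Filter.atTop (nhds (G t))) →
      ∃ e : ℝ, 0 ≤ e ∧ ∃ q : ℂ → ℂ,
        Literature.Analysis.InverseSpectral.HasStieltjesRepresentation q e
          ((hG.stieltjesFunction.measure).map (fun s : ℝ => s ^ 2)) ∧
        ∀ γ : ℝ, 0 < γ → q (-((γ ^ 2 : ℝ) : ℂ)) = ((L γ : ℝ) : ℂ) := by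
  intro F hF L hL hbd G hG hG0 hlim
  have htr := stub_truncatedConvergence F G (fun N => (hF N).1) (fun N => (hF N).2.1) hG hbd hlim
  obtain ⟨e, he, hdata⟩ :=
    stub_escapedMassConstant F G L hF hG hG0 hL (fun γ R hγ hR => htr γ R hγ hR)
  have hLC := stub_layerCake G hG hG0
  obtain ⟨hrep, hval⟩ :=
    stub_limitRepresentation G hG hG0 e he hLC (fun γ hγ => (hdata γ hγ).1)
  refine ⟨e, he, _, hrep, fun γ hγ => ?_⟩
  show (e : ℂ) + ∫ x : ℝ, ((x : ℂ) - (-((γ ^ 2 : ℝ) : ℂ)))⁻¹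
      ∂((hG.stieltjesFunction.measure).map (fun s : ℝ => s ^ 2)) = (L γ : ℂ)
  rw [hval γ hγ, (hdata γ hγ).2]

/-- **Uniqueness of the limit data**: two Stieltjes data sets whose functions agree at the points `-γ²`,
`γ > 0`, coincide — same escaped mass AND same measure. [cite: KacKrein1974, Supplement I §S1.4–S1.5] -/
theorem limitData_unique {q₁ q₂ : ℂ → ℂ} {e₁ e₂ : ℝ} {ν₁ ν₂ : Measure ℝ}
    (h₁ : HasStieltjesRepresentation q₁ e₁ ν₁) (h₂ : HasStieltjesRepresentation q₂ e₂ ν₂)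
    (hL : ∀ γ : ℝ, 0 < γ → q₁ (-((γ ^ 2 : ℝ) : ℂ)) = q₂ (-((γ ^ 2 : ℝ) : ℂ))) :
    e₁ = e₂ ∧ ν₁ = ν₂ := by
  have h : ∀ s : ℝ, 0 < s → q₁ (-(s : ℂ)) = q₂ (-(s : ℂ)) := fun s hs => by
    have h' := hL (Real.sqrt s) (Real.sqrt_pos.2 hs)
    rwa [Real.sq_sqrt hs.le] at h'
  have hEq := eqOn_of_hasStieltjesRepresentation_of_eqOn_neg h₁ h₂ h
  have h₂' : HasStieltjesRepresentation q₁ e₂ ν₂ :=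
    ⟨h₂.1, h₂.2.1, h₂.2.2.1, fun z hz => (hEq hz).trans (h₂.2.2.2 z hz)⟩
  exact stieltjes_data_unique h₁ h₂'

end Summit.AtomisticToContinuum.FouriersLaw.Theorems.ContactMeasureLimit

end
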